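import Literature.Computability.FineGrained.CliqueETHGroupingReduction
import Literature.Computability.FineGrained.CliqueETHTMBridge
import HarnessLib

/-!
# ETH-hardness of `k`-Clique: the grouping reduction on the word RAM, liberal form

This short file re-reads the verified word-RAM reduction program of
`CliqueETHReductionProgram.lean` / `CliqueETHGroupingReduction.lean` (Chen–Huang–Kanj–Xia, JCSS 72
(2006), Lemma 2.2 / Thm. 5.5: an `f(k) · N^{o(k)}` word-RAM clique algorithm decides sparse 3-SAT in
time `O(2^{δ n})`) in the **liberal** form `LiberalSparseKSATInRAMTime` of `CliqueETHTMBridge.lean`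
— clause lists with repetitions allowed and every word size from `kfit · (n + width)` on — which is
the hypothesis of the change-of-machine-model step of the Turing-machine route to
`not_kClique_inTimeInst_of_eth` (`not_kClique_inTimeInst_of_eth_of_tm`):

* `CliqueRed.Params.Fits.mono` — the word-size requirement `Fits` of the reduction program is
  monotone in the word size;
* `liberalSparseKSATInRAMTime_of_kCliqueInTimeNLittleOK_holds` —
  `KCliqueInTimeNLittleOK → ∀ c, ∀ δ > 0, LiberalSparseKSATInRAMTime 3 c δ`, by the proof of
  `sparseKSATInRAMTime_of_kCliqueInTimeNLittleOK_holds` verbatim (that proof never used the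
  `List.Nodup` component of a `kSATProblem 3` instance, and `reduction_outputsWithin` holds at
  every word size satisfying `Fits`);
* `not_kClique_inTimeInst_of_eth_of_tm'` — the assembly of `CliqueETHTMBridge.lean` with this
  hypothesis discharged: the target follows from Wave0's `sparsification` and the machine-model
  fact `sparseKSATInExpTime_of_liberalSparseKSATInRAMTime` alone.

## References

* J. Chen, X. Huang, I. A. Kanj, G. Xia, *Strong computational lower bounds via parameterized
  complexity*, JCSS 72 (2006) 1346–1367, Lemma 2.2 and Thm. 5.5.
-/

namespace Literature.Computability.FineGrained

open Filter Topology Cryptography Cryptography.WordRAM Complexity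

namespace CliqueRed

/-- The word-size requirement of the reduction program is monotone in the word size. [folklore] -/
theorem Params.Fits.mono {g : Params} {W W' : ℕ} (h : g.Fits W) (hW : W ≤ W') : g.Fits W' :=
  ⟨h.top.trans (Nat.pow_le_pow_right (by norm_num) hW), lt_of_lt_of_le h.ws_lt hW, h.width.trans hW⟩

/-- **Chen–Huang–Kanj–Xia, the grouping reduction on the word RAM, liberal form (proved).** If
`k`-Clique has an `f(k) · N^{o(k)}`-time word-RAM algorithm, then for every density `c` and every
`δ > 0` the clause lists `φ : CNF ℕ` of width `≤ 3` with `numClauses φ ≤ c · numVars φ` (repetitions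
allowed) are decided on the word RAM within `⌊C · 2^{δ n} + C⌋₊` steps at every word size
`W ≥ k' · (n + inputWidth (encodeCNFWords φ))`: the program, the constants and the estimates are
those of `sparseKSATInRAMTime_of_kCliqueInTimeNLittleOK_holds` (choice of `K` by
`eventually_forall_clique_time_le` with `a = 3 max(c, 1)` and target `δ/2`, `24 c ≤ δ K`, `K ≥ 2`;
`reduction_outputsWithin` at any word size with `Fits`, by `Params.fits` and `Fits.mono`; build cost
`Tpre_real_le`, emulated run `38 f(K) (N^{g(K)} + 1)`).
[cite: ChenHuangKanjXiaJCSS2006, Lemma 2.2 and Thm. 5.5] -/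
theorem _root_.Literature.Computability.FineGrained.liberalSparseKSATInRAMTime_of_kCliqueInTimeNLittleOK_holds :
    KCliqueInTimeNLittleOK → ∀ (c : ℕ) (δ : ℝ), 0 < δ → LiberalSparseKSATInRAMTime 3 c δ := by
  classical
  rintro ⟨f, gexp, hg, M, kM, hdet, hof, hM⟩ c δ hδ
  -- the choice of `K`
  have hδ2 : 0 < δ / 2 := by linarith
  have hδ4 : 0 < δ / 4 := by linarith
  have ha : (0 : ℝ) ≤ 3 * max (c : ℝ) 1 := by positivity
  have E1 := eventually_forall_clique_time_le f hg ha hδ2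
  have E2 : ∀ᶠ K : ℕ in atTop, 24 * (c : ℝ) ≤ δ * K := by
    have := tendsto_natCast_atTop_atTop (R := ℝ) |>.eventually_ge_atTop (24 * (c : ℝ) / δ)
    filter_upwards [this] with K hK
    rw [div_le_iff₀ hδ] at hK; linarith
  have E3 : ∀ᶠ K : ℕ in atTop, 2 ≤ K := eventually_ge_atTop 2
  obtain ⟨K, ⟨C₁, hC₁, hrun⟩, hKδ, hK2⟩ := (E1.and (E2.and E3)).exists
  obtain ⟨C₃, hC₃, hpoly⟩ := exists_sq_le_two_rpow hδ4
  -- the program and the constants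
  set cM := M.maxConst with hcM
  set Cb : ℝ := 300 * ((4 * c + 3) * C₃ + 640 * (K : ℝ) ^ 2 * ((c : ℝ) + 1) ^ 2 * C₃) + 4 with hCb
  have hCb0 : 0 ≤ Cb := by positivity
  refine ⟨reduction M K kM, Params.kfit K kM cM c, Cb + 38 * C₁, reduction_isDeterministic M K kM,
    reduction_isOracleFree M K kM, fun φ hw3 hsparse W hW => ?_⟩
  -- one instance
  set g : Params := ⟨φ, K, kM, cM⟩ with hgdef
  have hc : g.m ≤ c * g.φ.numVars := hsparse
  have hK : 2 ≤ g.K := hK2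
  have hF : g.Fits W := (g.fits hK hc).mono hW
  -- the clique program on the position instance
  obtain ⟨out, hout, hMrun⟩ := hM (posInstance g.φ g.K)
  rw [kClique_good_posInstance hK hw3, Set.mem_singleton_iff] at hout
  subst hout
  have hws : kM * kClique.width (posInstance g.φ g.K) = g.ws := by
    rw [kClique_width_posInstance, ← g.N_eq, sq]; rfl
  rw [hws] at hMrun
  have hred := g.reduction_outputsWithin hF hK hw3 hdet hof rfl hMrun
  refine ⟨_, (CNFSAT_good_iff φ _).2 rfl, hred.mono ?_⟩
  -- the time bound
  set n := g.φ.numVars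
  apply Nat.le_floor
  have hpos : (0 : ℝ) < (2 : ℝ) ^ (δ * n) := by positivity
  have hn0 : (0 : ℝ) ≤ n := Nat.cast_nonneg _
  have hhalf : (2 : ℝ) ^ (δ / 2 * n) ≤ (2 : ℝ) ^ (δ * n) :=
    Real.rpow_le_rpow_of_exponent_le one_le_two (by nlinarith)
  have hN : ((posInstance g.φ g.K).n : ℝ) ≤ K * (2 : ℝ) ^ (3 * max (c : ℝ) 1 * ((n : ℝ) / K + 1)) := by
    rw [← g.N_eq]; exact g.N_real_le (by omega) hc
  have hT := hrun n (posInstance g.φ g.K).n hN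
  have hB := g.Tpre_real_le hK hw3 hc hδ hKδ hC₃ hpoly
  unfold Params.Ttotal
  push_cast
  have hcs : (cstep : ℝ) = 38 := by norm_num [cstep]
  rw [hcs]
  calc (g.Tpre : ℝ) + 38 * ((f K : ℝ) * ((⌊((posInstance g.φ g.K).n : ℝ) ^ gexp K⌋₊ : ℝ) + 1)) + 4
      ≤ Cb * (2 : ℝ) ^ (δ / 2 * n) + 38 * (C₁ * (2 : ℝ) ^ (δ / 2 * n)) := by linarith
    _ ≤ Cb * (2 : ℝ) ^ (δ * n) + 38 * (C₁ * (2 : ℝ) ^ (δ * n)) := by gcongr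
    _ = (Cb + 38 * C₁) * (2 : ℝ) ^ (δ * n) := by ring
    _ ≤ (Cb + 38 * C₁) * (2 : ℝ) ^ (δ * n) + (Cb + 38 * C₁) := by linarith

end CliqueRed

/-- **Assembly with the word-RAM side discharged (proved).** Wave0's sparsification lemma and the
change of machine model `sparseKSATInExpTime_of_liberalSparseKSATInRAMTime` imply
`not_kClique_inTimeInst_of_eth`. [cite: ChenHuangKanjXiaJCSS2006, Thm. 5.5] -/
theorem not_kClique_inTimeInst_of_eth_of_tm' (hS : sparsification)
    (hB : sparseKSATInExpTime_of_liberalSparseKSATInRAMTime) : not_kClique_inTimeInst_of_eth :=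
  not_kClique_inTimeInst_of_eth_of_tm hS hB liberalSparseKSATInRAMTime_of_kCliqueInTimeNLittleOK_holds

end Literature.Computability.FineGrained
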